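import Summits.HodgeConjecture.HodgeCM.Automorphic.ThetaPending_1

/-! PORT of `HodgeCM/Automorphic/ThetaPending.lean` (HodgeCMPerL run 81) — part 2: continuation of `Summits.HodgeConjecture.HodgeCM.Automorphic.ThetaPending_1` (split at a top-level declaration boundary by port_pkg.py; scope re-opened below; declarations unchanged). -/

-- port_pkg: scope re-opened for this part (file-level context, then the namespace/section stack open at the cut)
set_option autoImplicit false
noncomputable section
open scoped TensorProduct
universe u
namespace HodgeCM.Automorphic.ThetaPending
open HodgeCM.Literature.Theta
local notation "⟪" x ", " y "⟫" => @inner ℂ _ _ x y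
namespace RallisDatum
variable (D : RallisDatum.{u})
variable {D}
/-- **PerL v5 l. 631–632, kernel-checked from the typed formula:** if the adelic matrix-coefficient integral
is a positive real number then the lift is non-zero (`π_i ≠ 0`). -/
theorem Pending_RallisInnerProductConvergent.lift_ne_zero (h : D.Pending_RallisInnerProductConvergent)
    {φ : D.S} {f : D.X} {t : ℝ} (ht : 0 < t) (hI : D.mcInt φ f = (t : ℂ)) : D.lift φ f ≠ 0 := by
  intro h0
  have key := h.2 φ f
  rw [h0, inner_zero_left, hI] at key
  have : (0 : ℂ) = ((D.c * t : ℝ) : ℂ) := by rw [key]; push_cast; ring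
  have hct : D.c * t = 0 := by exact_mod_cast this.symm
  exact (mul_pos h.1 ht).ne' hct

/-! ### v3: the pending statement is [Li92, Thm 2.1] for the datum a `Li92Datum` induces -/

/-- The `RallisDatum` underlying a `Li92Datum` [Li92, §§1–2]: `S = S(X(𝔸))`, `X = H_π` (the cusp forms being
lifted), `HG = L²(G(k)\G̃(𝔸))`, `lift φ f = θ^f_φ` (4), `mcInt φ f = ∫_{G̃'(𝔸)} ⟨ω(h)φ, φ⟩ ⟨π(h)f, f⟩ dh` (the
right hand side of (26) on the diagonal; for an automorphic CHARACTER `f = χ'` of `[U(W_i)]` this is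
`vol([U(W_i)]) · ∫ ⟨ω(y)φ, φ⟩ χ'(y) dy`, PerL tex ll. 603–609), and `c = 1` (Li's measure normalisations;
PerL's `c · vol` is absorbed in `mcInt`). -/
def ofLi92 (L : Li92Datum.{u}) : RallisDatum.{u} where
  S := L.S
  X := L.Hπ
  HG := L.L2G
  lift := L.lift
  mcInt := fun φ f => L.haar fun y => ⟪φ, L.ω y φ⟫ * ⟪f, L.π y f⟫
  c := 1

/-- **v3 (kernel): `Pending_RallisInnerProductConvergent` holds for the datum induced by a `Li92Datum`
satisfying [Li92, Thm 2.1] in Li's range `n > 2n' + 4ε − 2`** — the open input of v2 is print + dictionary. -/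
theorem pending_of_Li92 (L : Li92Datum.{u}) (h : L.RallisInnerProductFormula) (hcr : L.convergentRange) :
    (ofLi92 L).Pending_RallisInnerProductConvergent := by
  refine ⟨one_pos, fun φ f => ?_⟩
  dsimp only [ofLi92]
  rw [Complex.ofReal_one, one_mul]
  exact h.normSq_eq hcr φ f

end RallisDatum

end HodgeCM.Automorphic.ThetaPending

end
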